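import Mathlib
import Literature.Probability.LatticeModels.MagnetizationExponentUpperProofs
import HarnessLib

/-!
# Edge of the Bernstein cone: `⟨σ₀σ_x⟩⁺_{β_c} = Σ_n a_n(x) tanhⁿβ_c`

Helper file for item `stmt-CriticalPhenomena-8360`
(`Summit.CriticalPhenomena.Ising3DConformalLimit.Theses.BernsteinTemperature.KernelTransfer`).

If, for a site `x ≠ 0` of `ℤ^d` (`d ≥ 3`), the plus-state two-point function is a power series in
`v = tanh β` with non-negative coefficients on `[0, β_c)`, `⟨σ₀σ_x⟩⁺_β = Σ_n a_n tanhⁿβ`, then the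
series still converges AT `β_c` and sums to the critical two-point function
(`hasSum_criticalTwoPoint_of_hasSum_below`). Monotone convergence bounds the partial sums by
`⟨σ₀σ_x⟩⁺_{β_c}` (the plus state is non-decreasing in `β`); the reverse inequality is the
left-continuity of the FREE state in `β` (`freeCorr_continuousWithinAt_Iic`) together with
`⟨·⟩^∅ ≤ ⟨·⟩⁺` and the continuity of the transition on pairs, `⟨σ₀σ_x⟩⁺_{β_c} = ⟨σ₀σ_x⟩^∅_{β_c}`
for `d ≥ 3` (`twoPointPlus_criticalBeta_eq_twoPointFree_holds`, Aizenman–Duminil-Copin–Sidoravicius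
2015). No definitions are introduced.
-/

noncomputable section

namespace Summit.CriticalPhenomena.Ising3DConformalLimit.Theorems.KernelTransfer

open Filter Topology Finset
open Literature.Probability.LatticeModels

variable {d : ℕ}

/-- The plus-state two-point function is non-decreasing in `β ≥ 0` (GKS, `plusCorr_mono_params`). -/
theorem twoPointPlus_mono {β β' : ℝ} (hβ : 0 ≤ β) (hββ' : β ≤ β') (x : Site d) :
    twoPointPlus d β x ≤ twoPointPlus d β' x := by
  by_cases hx : x = 0
  · subst hx; simp [twoPointPlus_zero]
  rw [twoPointPlus_eq_plusCorr β hx, twoPointPlus_eq_plusCorr β' hx]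
  exact plusCorr_mono_params hβ hββ' le_rfl le_rfl _

/-- **Partial sums at the edge.** If `Σ_n a_n tanhⁿβ = ⟨σ₀σ_x⟩⁺_β` with `a_n ≥ 0` for all
`0 ≤ β < β_c` (`d ≥ 2`, so that `β_c > 0`), then every partial sum of `Σ_n a_n tanhⁿβ_c` is at most
`⟨σ₀σ_x⟩⁺_{β_c}`. -/
theorem sum_range_mul_tanh_criticalBeta_pow_le (hd : 2 ≤ d) (x : Site d) {a : ℕ → ℝ}
    (ha : ∀ n, 0 ≤ a n)
    (hsum : ∀ β : ℝ, 0 ≤ β → β < criticalBeta d →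
      HasSum (fun n => a n * Real.tanh β ^ n) (twoPointPlus d β x)) (N : ℕ) :
    ∑ n ∈ range N, a n * Real.tanh (criticalBeta d) ^ n ≤ criticalTwoPoint d x := by
  have hβc : 0 < criticalBeta d := criticalBeta_pos_holds (d := d) hd
  have htanh0 : ∀ {β : ℝ}, 0 ≤ β → 0 ≤ Real.tanh β := fun hβ => by simpa using tanh_le_tanh hβ
  have htanhc : Continuous Real.tanh := by
    rw [show Real.tanh = fun y => Real.sinh y / Real.cosh y from funext Real.tanh_eq_sinh_div_cosh]
    exact Real.continuous_sinh.div Real.continuous_cosh fun y => (Real.cosh_pos y).ne'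
  have hle : ∀ β, 0 ≤ β → β < criticalBeta d →
      ∑ n ∈ range N, a n * Real.tanh β ^ n ≤ criticalTwoPoint d x := by
    intro β hβ hβ'
    refine (sum_le_hasSum (range N) (fun n _ => mul_nonneg (ha n) (pow_nonneg (htanh0 hβ) n))
      (hsum β hβ hβ')).trans ?_
    exact twoPointPlus_mono hβ hβ'.le x
  have hcont : Continuous fun β : ℝ => ∑ n ∈ range N, a n * Real.tanh β ^ n :=
    continuous_finsetSum _ fun n _ => continuous_const.mul (htanhc.pow n)
  have htend : Tendsto (fun β : ℝ => ∑ n ∈ range N, a n * Real.tanh β ^ n)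
      (𝓝[<] criticalBeta d) (𝓝 (∑ n ∈ range N, a n * Real.tanh (criticalBeta d) ^ n)) :=
    (hcont.tendsto _).mono_left nhdsWithin_le_nhds
  have h1 : ∀ᶠ β in 𝓝[<] criticalBeta d, β < criticalBeta d := self_mem_nhdsWithin
  have h2 : ∀ᶠ β in 𝓝[<] criticalBeta d, 0 < β := mem_nhdsWithin_of_mem_nhds (lt_mem_nhds hβc)
  exact le_of_tendsto htend (by filter_upwards [h1, h2] with β hβ1 hβ2 using hle β hβ2.le hβ1)

/-- **Summability at the edge** (monotone convergence): under the hypotheses of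
`sum_range_mul_tanh_criticalBeta_pow_le`, `Σ_n a_n tanhⁿβ_c` converges and its sum is at most
`⟨σ₀σ_x⟩⁺_{β_c}`. -/
theorem summable_mul_tanh_criticalBeta_pow (hd : 2 ≤ d) (x : Site d) {a : ℕ → ℝ}
    (ha : ∀ n, 0 ≤ a n)
    (hsum : ∀ β : ℝ, 0 ≤ β → β < criticalBeta d →
      HasSum (fun n => a n * Real.tanh β ^ n) (twoPointPlus d β x)) :
    Summable (fun n => a n * Real.tanh (criticalBeta d) ^ n) ∧
      ∑' n, a n * Real.tanh (criticalBeta d) ^ n ≤ criticalTwoPoint d x := by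
  have hβc : 0 < criticalBeta d := criticalBeta_pos_holds (d := d) hd
  have hvc : 0 ≤ Real.tanh (criticalBeta d) := by simpa using tanh_le_tanh hβc.le
  have h0 : ∀ n, 0 ≤ a n * Real.tanh (criticalBeta d) ^ n := fun n =>
    mul_nonneg (ha n) (pow_nonneg hvc n)
  exact ⟨summable_of_sum_range_le h0 (sum_range_mul_tanh_criticalBeta_pow_le hd x ha hsum),
    Real.tsum_le_of_sum_range_le h0 (sum_range_mul_tanh_criticalBeta_pow_le hd x ha hsum)⟩

/-- **The edge identity.** For `d ≥ 3` and `x ≠ 0`: if `⟨σ₀σ_x⟩⁺_β = Σ_n a_n tanhⁿβ` with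
`a_n ≥ 0` for all `0 ≤ β < β_c`, then `Σ_n a_n tanhⁿβ_c = ⟨σ₀σ_x⟩⁺_{β_c}` (convergent). The
inequality `≤` is monotone convergence; `≥` uses `⟨σ₀σ_x⟩^∅_β ≤ ⟨σ₀σ_x⟩⁺_β = Σ_n a_n tanhⁿβ ≤
Σ_n a_n tanhⁿβ_c` for `β < β_c`, the left-continuity of the free state at `β_c` and
`⟨σ₀σ_x⟩⁺_{β_c} = ⟨σ₀σ_x⟩^∅_{β_c}` (`d ≥ 3`). -/
theorem hasSum_criticalTwoPoint_of_hasSum_below (hd : 3 ≤ d) {x : Site d} (hx : x ≠ 0)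
    {a : ℕ → ℝ} (ha : ∀ n, 0 ≤ a n)
    (hsum : ∀ β : ℝ, 0 ≤ β → β < criticalBeta d →
      HasSum (fun n => a n * Real.tanh β ^ n) (twoPointPlus d β x)) :
    HasSum (fun n => a n * Real.tanh (criticalBeta d) ^ n) (criticalTwoPoint d x) := by
  have hd2 : 2 ≤ d := by omega
  have hβc : 0 < criticalBeta d := criticalBeta_pos_holds (d := d) hd2
  obtain ⟨hsumm, hle⟩ := summable_mul_tanh_criticalBeta_pow hd2 x ha hsum
  set S := ∑' n, a n * Real.tanh (criticalBeta d) ^ n with hS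
  -- the free state below `β_c` is bounded by `S`
  have hfree_le : ∀ β, 0 ≤ β → β < criticalBeta d → freeCorr d β 0 {0, x} ≤ S := by
    intro β hβ hβ'
    calc freeCorr d β 0 {0, x} ≤ plusCorr d β 0 {0, x} := freeCorr_le_plusCorr hβ le_rfl _
      _ = twoPointPlus d β x := (twoPointPlus_eq_plusCorr β hx).symm
      _ = ∑' n, a n * Real.tanh β ^ n := (hsum β hβ hβ').tsum_eq.symm
      _ ≤ S := by
        refine (hsum β hβ hβ').summable.tsum_le_tsum (fun n => ?_) hsumm
        have hβ0 : 0 ≤ Real.tanh β := by simpa using tanh_le_tanh hβ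
        exact mul_le_mul_of_nonneg_left (pow_le_pow_left₀ hβ0 (tanh_le_tanh hβ'.le) n) (ha n)
  -- left-continuity of the free state at `β_c`
  have hfree_tend : Tendsto (fun β => freeCorr d β 0 {0, x}) (𝓝[<] criticalBeta d)
      (𝓝 (freeCorr d (criticalBeta d) 0 {0, x})) :=
    (freeCorr_continuousWithinAt_Iic (d := d) le_rfl {0, x} hβc).tendsto.mono_left
      (nhdsWithin_mono _ Set.Iio_subset_Iic_self)
  have hTfree : criticalTwoPoint d x = freeCorr d (criticalBeta d) 0 {0, x} := by
    rw [criticalTwoPoint, twoPointPlus_criticalBeta_eq_twoPointFree_holds hd x,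
      twoPointFree_eq_freeCorr _ hx]
  have h1 : ∀ᶠ β in 𝓝[<] criticalBeta d, β < criticalBeta d := self_mem_nhdsWithin
  have h2 : ∀ᶠ β in 𝓝[<] criticalBeta d, 0 < β := mem_nhdsWithin_of_mem_nhds (lt_mem_nhds hβc)
  have hge : criticalTwoPoint d x ≤ S := by
    rw [hTfree]
    exact le_of_tendsto hfree_tend
      (by filter_upwards [h1, h2] with β hβ1 hβ2 using hfree_le β hβ2.le hβ1)
  have heq : S = criticalTwoPoint d x := le_antisymm hle hge
  exact heq ▸ hsumm.hasSum

end Summit.CriticalPhenomena.Ising3DConformalLimit.Theorems.KernelTransfer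

end
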